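import Literature.MathematicalPhysics.QuantumLattice.GrassmannWeightedGaussConvBinomialGramPrescribed
import Literature.MathematicalPhysics.QuantumLattice.GrassmannGaussConvKernelBound
import Literature.MathematicalPhysics.QuantumLattice.GrassmannPolchinskiEquation
import HarnessLib

/-!
# The linear part of the renormalisation-group map MINUS ITS ONE-LINE TERM, binomial–Gram form, prescribed output legs, weighted

Topic `MathematicalPhysics/QuantumLattice`; companion of `GrassmannWeightedGaussConvBinomialGramPrescribed`
(Benfatto–Giuliani–Mastropietro 2006, (2.61)–(2.63), (2.66), (2.77)–(2.80), (2.86)–(2.90) with §3 (3.2)–(3.8); Salmhofer 1999 §4.3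
(4.86)–(4.95)).  The three-piece split of one Gaussian step `e^{Δ_C}H + (effAction − e^{Δ_C}H)` separates, inside the linear part
`e^{Δ_C}H − H`, the ONE-LINE term `Δ_C H` (one self-contraction: in degree `2p` it is fed by the degree-`2p+2` kernel only — the
TADPOLE of a quartic input when `p = 1`) from the terms with AT LEAST TWO self-contractions `e^{Δ_C}H − H − Δ_C H`.  This file bounds the
latter exactly as `sum_wt_norm_kernel_gaussConv_sub_le_binomial_prescribed_of_gramBounded` bounds the former: the same binomial–Gram sum,
now over the input degrees `2m′ ≥ 2p + 4` only (`m′ > p + 1`).  The degree bookkeeping is the only new ingredient: for a homogeneous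
element of degree `k`, `kernel_n (Δ_C^j ·) = 0` unless `n + 2j = k`.

* `kernel_grassmannLaplacian_pow_presented_eq_zero` — `kernel_n (Δ_C^j (presented cf)) = 0` for `cf` of degree `k ≠ n + 2j`;
* `kernel_gaussConv_presented_self` — in its own degree `k`, `e^{Δ_C}` does not change a homogeneous element's kernel;
* `kernel_gaussConv_presented_sub_two` — two degrees below, the kernel of `e^{Δ_C}(presented cf)` is that of `Δ_C (presented cf)`;
* `kernel_gaussConv_sub_sub_laplacian_eq` — in degree `2p`, `e^{Δ_C}H − H − Δ_C H` and `e^{Δ_C}H″` have the same kernel, `H″ := H` minus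
  its degree-`2p` and degree-`2p+2` parts;
* **`sum_wt_norm_kernel_gaussConv_sub_sub_laplacian_le_binomial_prescribed_of_gramBounded`** — the weighted prescribed binomial–Gram bound
  for `e^{Δ_C}H − H − Δ_C H` in degree `2p`, summed over `m′ > p + 1`.

Everything is proved; no definition, no named fact.

## Sources

G. Benfatto, A. Giuliani, V. Mastropietro, Ann. Henri Poincaré 7 (2006) 809–898, (2.61)–(2.63), (2.66), (2.77)–(2.80), (2.86)–(2.90),
§3 (3.2)–(3.8) [`BenfattoGiulianiMastropietro2006`]; M. Salmhofer, *Renormalization* (1999), §4.3 (4.86)–(4.95) [`Salmhofer1999`].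
-/

noncomputable section

namespace Literature.MathematicalPhysics.QuantumLattice

open GrassmannAlgebra Finset Literature.Probability.LatticeModels Literature.Probability.LatticeModels.BattleFederbush
open scoped Nat

universe u

variable {𝕜 : Type*} [RCLike 𝕜] {Γ : Type u} [Fintype Γ] [DecidableEq Γ] {wt : Finset Γ → ℝ} (C : Matrix Γ Γ 𝕜)

/-! ### Degree bookkeeping for powers of the Laplacian on a homogeneous element -/

omit [Fintype Γ] [DecidableEq Γ] in
/-- The kernels are additive: `kernel (F - G) = kernel F - kernel G`. [folklore] -/
private theorem kernel_sub_aux₃ (F G : GrassmannAlgebra 𝕜 Γ) (m : ℕ) (X : Fin m → Γ) :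
    kernel 𝕜 (F - G) m X = kernel 𝕜 F m X - kernel 𝕜 G m X := by
  rw [sub_eq_add_neg, kernel_add, show -G = (-1 : 𝕜) • G from (neg_one_smul 𝕜 G).symm, kernel_smul]
  ring

/-- **`kernel_n (Δ_C^j (presented cf)) = 0` unless `n + 2j = k`** for a coefficient function `cf` of degree `k`: every application of
`Δ_C` removes two fields (Salmhofer 1999 (4.86): `kernel_n (Δ_C W)` is the degree-`n+2` kernel of `W` contracted on one pair).
[cite: Salmhofer1999, §4.3.2 (4.86)] -/
theorem kernel_grassmannLaplacian_pow_presented_eq_zero {k : ℕ} (cf : (Fin k → Γ) → 𝕜) :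
    ∀ (j n : ℕ), n + 2 * j ≠ k → ∀ X : Fin n → Γ,
      kernel 𝕜 ((grassmannLaplacian 𝕜 C ^ j) (presented 𝕜 cf)) n X = 0 := by
  intro j
  induction j with
  | zero =>
    intro n hn X
    rw [pow_zero, Module.End.one_apply]
    exact kernel_presented_of_ne 𝕜 cf X (by omega)
  | succ j ih =>
    intro n hn X
    rw [pow_succ', Module.End.mul_apply, kernel_grassmannLaplacian]
    refine mul_eq_zero_of_right _ (sum_eq_zero fun A _ => sum_eq_zero fun B _ => ?_)
    rw [ih (n + 2) (by omega), mul_zero]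

/-- **In its own degree a homogeneous element is untouched by `e^{Δ_C}`**: `kernel_k (e^{Δ_C} (presented cf)) = kernel_k (presented cf)`
(`e^{Δ_C} = Σ_i Δ_C^i / i!` and only `i = 0` reaches degree `k`). [cite: Salmhofer1999, §4.3.2 (4.86)] -/
theorem kernel_gaussConv_presented_self {k : ℕ} (cf : (Fin k → Γ) → 𝕜) (X : Fin k → Γ) :
    kernel 𝕜 (gaussConv 𝕜 C (presented 𝕜 cf)) k X = kernel 𝕜 (presented 𝕜 cf) k X := by
  rw [gaussConv_eq_sum_range 𝕜 C, LinearMap.coe_sum, Finset.sum_apply, kernel_sum]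
  rw [sum_eq_single_of_mem 0 (mem_range.2 (by omega))]
  · rw [LinearMap.smul_apply, ← Rat.cast_smul_eq_qsmul 𝕜, kernel_smul, pow_zero, Module.End.one_apply]
    simp
  · intro i _ hi
    rw [LinearMap.smul_apply, ← Rat.cast_smul_eq_qsmul 𝕜, kernel_smul,
      kernel_grassmannLaplacian_pow_presented_eq_zero C cf i k (by omega) X, mul_zero]

/-- **Two degrees below, `e^{Δ_C}` acts on a homogeneous element as `Δ_C`**: for `cf` of degree `n + 2`,
`kernel_n (e^{Δ_C} (presented cf)) = kernel_n (Δ_C (presented cf))` (only `i = 1` reaches degree `n`). [cite: Salmhofer1999, §4.3.2 (4.86)] -/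
theorem kernel_gaussConv_presented_sub_two {n : ℕ} (cf : (Fin (n + 2) → Γ) → 𝕜) (X : Fin n → Γ) :
    kernel 𝕜 (gaussConv 𝕜 C (presented 𝕜 cf)) n X = kernel 𝕜 (grassmannLaplacian 𝕜 C (presented 𝕜 cf)) n X := by
  rw [gaussConv_eq_sum_range 𝕜 C, LinearMap.coe_sum, Finset.sum_apply, kernel_sum]
  rw [sum_eq_single_of_mem 1 (mem_range.2 (by omega))]
  · rw [LinearMap.smul_apply, ← Rat.cast_smul_eq_qsmul 𝕜, kernel_smul, pow_one]
    simp
  · intro i _ hi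
    rw [LinearMap.smul_apply, ← Rat.cast_smul_eq_qsmul 𝕜, kernel_smul,
      kernel_grassmannLaplacian_pow_presented_eq_zero C cf i n (by omega) X, mul_zero]

/-! ### The linear part minus the identity and minus the one-line term, degree `2p` -/

/-- **In degree `2p`, `e^{Δ_C}H − H − Δ_C H` and `e^{Δ_C}H″` have the same kernel**, where `H″ := H − H_{2p} − H_{2p+2}` is `H` with
its homogeneous parts of degrees `2p` and `2p + 2` removed (`H_{k} := presented (kernel H k)`): the degree-`2p` part contributes
`e^{Δ}H_{2p} − H_{2p} = 0` and `Δ H_{2p} = 0` in degree `2p`; the degree-`2p+2` part contributes `e^{Δ}H_{2p+2} − Δ H_{2p+2} = 0` and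
`H_{2p+2} = 0` in degree `2p`; and `H″`, `Δ_C H″` have no degree-`2p` kernel.
[cite: BenfattoGiulianiMastropietro2006, (2.86)-(2.90)] -/
theorem kernel_gaussConv_sub_sub_laplacian_eq (H : GrassmannAlgebra 𝕜 Γ) (p : ℕ) (W : Fin (2 * p) → Γ) :
    kernel 𝕜 (gaussConv 𝕜 C H - H - grassmannLaplacian 𝕜 C H) (2 * p) W =
      kernel 𝕜 (gaussConv 𝕜 C (H - presented 𝕜 (kernel 𝕜 H (2 * p)) - presented 𝕜 (kernel 𝕜 H (2 * p + 2)))) (2 * p) W := by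
  set Hp : GrassmannAlgebra 𝕜 Γ := presented 𝕜 (kernel 𝕜 H (2 * p)) with hHp
  set Hq : GrassmannAlgebra 𝕜 Γ := presented 𝕜 (kernel 𝕜 H (2 * p + 2)) with hHq
  set H'' : GrassmannAlgebra 𝕜 Γ := H - Hp - Hq with hH''
  have hH : H = H'' + Hp + Hq := by rw [hH'']; abel
  -- kernels of the parts in degrees `2p` and `2p + 2`
  have hHp_top : ∀ Y : Fin (2 * p) → Γ, kernel 𝕜 Hp (2 * p) Y = kernel 𝕜 H (2 * p) Y := fun Y => by
    rw [hHp, kernel_presented_kernel]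
  have hHq_top : ∀ Y : Fin (2 * p + 2) → Γ, kernel 𝕜 Hq (2 * p + 2) Y = kernel 𝕜 H (2 * p + 2) Y := fun Y => by
    rw [hHq, kernel_presented_kernel]
  have hHp_q : ∀ Y : Fin (2 * p + 2) → Γ, kernel 𝕜 Hp (2 * p + 2) Y = 0 := fun Y => by
    rw [hHp, kernel_presented_of_ne 𝕜 _ Y (by omega)]
  have hHq_p : ∀ Y : Fin (2 * p) → Γ, kernel 𝕜 Hq (2 * p) Y = 0 := fun Y => by
    rw [hHq, kernel_presented_of_ne 𝕜 _ Y (by omega)]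
  have hH''_p : ∀ Y : Fin (2 * p) → Γ, kernel 𝕜 H'' (2 * p) Y = 0 := fun Y => by
    rw [hH'', kernel_sub_aux₃, kernel_sub_aux₃, hHp_top, hHq_p, sub_zero, sub_self]
  have hH''_q : ∀ Y : Fin (2 * p + 2) → Γ, kernel 𝕜 H'' (2 * p + 2) Y = 0 := fun Y => by
    rw [hH'', kernel_sub_aux₃, kernel_sub_aux₃, hHp_q, hHq_top, sub_zero, sub_self]
  -- the one-line term of each part in degree `2p`
  have hΔHp : kernel 𝕜 (grassmannLaplacian 𝕜 C Hp) (2 * p) W = 0 := by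
    have h := kernel_grassmannLaplacian_pow_presented_eq_zero C (kernel 𝕜 H (2 * p)) 1 (2 * p) (by omega) W
    rwa [pow_one] at h
  have hΔH'' : kernel 𝕜 (grassmannLaplacian 𝕜 C H'') (2 * p) W = 0 := by
    rw [kernel_grassmannLaplacian]
    refine mul_eq_zero_of_right _ (sum_eq_zero fun A _ => sum_eq_zero fun B _ => ?_)
    rw [show 2 * p + 2 = 2 * p + 2 from rfl] at hH''_q
    rw [hH''_q, mul_zero]
  -- the Gaussian convolution of each homogeneous part in degree `2p`
  have hEHp : kernel 𝕜 (gaussConv 𝕜 C Hp) (2 * p) W = kernel 𝕜 Hp (2 * p) W := by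
    rw [hHp]; exact kernel_gaussConv_presented_self C _ W
  have hEHq : kernel 𝕜 (gaussConv 𝕜 C Hq) (2 * p) W = kernel 𝕜 (grassmannLaplacian 𝕜 C Hq) (2 * p) W := by
    rw [hHq]; exact kernel_gaussConv_presented_sub_two C _ W
  -- assemble
  have hdec : gaussConv 𝕜 C H - H - grassmannLaplacian 𝕜 C H =
      gaussConv 𝕜 C H'' + ((gaussConv 𝕜 C Hp - Hp - grassmannLaplacian 𝕜 C Hp) +
        (gaussConv 𝕜 C Hq - Hq - grassmannLaplacian 𝕜 C Hq) - (H'' + grassmannLaplacian 𝕜 C H'')) := by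
    conv_lhs => rw [hH]
    rw [map_add, map_add, map_add, map_add]
    abel
  rw [hdec, kernel_add, kernel_sub_aux₃, kernel_add, kernel_sub_aux₃, kernel_sub_aux₃, kernel_sub_aux₃, kernel_sub_aux₃,
    kernel_add, hEHp, hΔHp, hEHq, hHq_p, hH''_p W, hΔH'']
  ring

/-- **`e^{Δ_C} H − H − Δ_C H` in binomial–Gram form with prescribed output legs, weighted**: in an even degree `2p` only the kernels
of `H` of degrees `2m′ ≥ 2p + 4` contribute (at least two self-contractions), each with `|J|` legs constrained and one pinned
(weighted norms):
`Σ_W wt(W) ‖kernel_{2p} (e^{Δ_C} H − H − Δ_C H) (W)‖ ≤ Σ_{p+1 < m' ≤ |Γ|/2} ((2p)!)⁻¹ (∏_{j∉J}(2m'-j)) (2m')^{|J|} κ^{2m'-2p} N(m', |J|)`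
— the right side of `sum_wt_norm_kernel_gaussConv_sub_le_binomial_prescribed_of_gramBounded` without its `m′ = p + 1` (one-line) term.
[cite: BenfattoGiulianiMastropietro2006, (2.61)-(2.63), (2.66), (2.86)-(2.90), §3 (3.2)-(3.8) and Lemma 2.6] -/
theorem sum_wt_norm_kernel_gaussConv_sub_sub_laplacian_le_binomial_prescribed_of_gramBounded (hwt : IsTreeWeight wt) {κ : ℝ}
    (hκ : 0 ≤ κ) (hGB : IsGramBoundedR C κ) (H : GrassmannAlgebra 𝕜 Γ) (hH : H ∈ evenPart 𝕜 Γ) {p : ℕ} (J : Finset (Fin (2 * p)))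
    (A : Fin (2 * p) → Γ → Bool)
    (N : ℕ → ℕ → ℝ) (hN0 : ∀ m' F, 0 ≤ N m' F)
    (hN : ∀ (m' : ℕ) (T : Finset (Fin (2 * p))), T ⊆ J → ∀ (ι : T → Fin (2 * m')), Function.Injective ι →
      ∀ (t : Fin (2 * m')), (∀ j, ι j ≠ t) → ∀ a : Γ,
        ∑ Y ∈ univ.filter (fun Y : Fin (2 * m') → Γ => Y t = a),
          ‖kernel 𝕜 H (2 * m') Y‖ * wt (univ.image Y) * ∏ j : T, (if A j (Y (ι j)) = true then (1 : ℝ) else 0) ≤ N m' T.card)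
    (i : Fin (2 * p)) (hi : i ∉ J) (w : Γ) :
    ∑ W ∈ univ.filter (fun W : Fin (2 * p) → Γ => W i = w ∧ ∀ j ∈ J, A j (W j) = true),
        wt (univ.image W) * ‖kernel 𝕜 (gaussConv 𝕜 C H - H - grassmannLaplacian 𝕜 C H) (2 * p) W‖ ≤
      ∑ m' ∈ range (Fintype.card Γ / 2 + 1), if p + 1 < m' then
        ((((2 * p).factorial : ℝ))⁻¹ * ((∏ j ∈ univ.filter (fun j : Fin (2 * p) => j ∉ J), (2 * m' - (j : ℕ)) : ℕ) : ℝ)) *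
          ((2 * m' : ℕ) : ℝ) ^ J.card * κ ^ (2 * m' - 2 * p) * N m' J.card else 0 := by
  -- the degree-`2p` and degree-`2p+2` parts of `H` and the rest
  set Hp : GrassmannAlgebra 𝕜 Γ := presented 𝕜 (kernel 𝕜 H (2 * p)) with hHp
  set Hq : GrassmannAlgebra 𝕜 Γ := presented 𝕜 (kernel 𝕜 H (2 * p + 2)) with hHq
  have hpres_even : ∀ q : ℕ, (presented 𝕜 (kernel 𝕜 H (2 * q)) : GrassmannAlgebra 𝕜 Γ) ∈ evenPart 𝕜 Γ := by
    intro q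
    have hcoe : presented 𝕜 (kernel 𝕜 H (2 * q)) =
        ((∑ Y : Fin (2 * q) → Γ, kernel 𝕜 H (2 * q) Y • evenGenProd (even_two_mul q) Y : evenPart 𝕜 Γ) : GrassmannAlgebra 𝕜 Γ) := by
      rw [AddSubmonoidClass.coe_finsetSum, presented]
      exact sum_congr rfl fun Y _ => by rw [Subalgebra.coe_smul, coe_evenGenProd]
    rw [hcoe]
    exact Subtype.mem _
  have hHp_even : Hp ∈ evenPart 𝕜 Γ := hpres_even p
  have hHq_even : Hq ∈ evenPart 𝕜 Γ := by
    have h := hpres_even (p + 1)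
    rwa [show 2 * (p + 1) = 2 * p + 2 by ring] at h
  set H'' : GrassmannAlgebra 𝕜 Γ := H - Hp - Hq with hH''
  have hH''even : H'' ∈ evenPart 𝕜 Γ := sub_mem (sub_mem hH hHp_even) hHq_even
  -- kernels of `H''`: zero in degrees `2p`, `2p+2`, those of `H` elsewhere
  have hkerH''_p : ∀ Y : Fin (2 * p) → Γ, kernel 𝕜 H'' (2 * p) Y = 0 := fun Y => by
    rw [hH'', kernel_sub_aux₃, kernel_sub_aux₃, hHp, kernel_presented_kernel, hHq, kernel_presented_of_ne 𝕜 _ Y (by omega),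
      sub_zero, sub_self]
  have hkerH''_q : ∀ Y : Fin (2 * p + 2) → Γ, kernel 𝕜 H'' (2 * p + 2) Y = 0 := fun Y => by
    rw [hH'', kernel_sub_aux₃, kernel_sub_aux₃, hHp, kernel_presented_of_ne 𝕜 _ Y (by omega), hHq, kernel_presented_kernel,
      sub_zero, sub_self]
  have hkerH''_q' : ∀ Y : Fin (2 * (p + 1)) → Γ, kernel 𝕜 H'' (2 * (p + 1)) Y = 0 := fun Y => hkerH''_q Y
  have hkerH''_ne : ∀ {m' : ℕ}, m' ≠ p → m' ≠ p + 1 → ∀ Y : Fin (2 * m') → Γ, kernel 𝕜 H'' (2 * m') Y = kernel 𝕜 H (2 * m') Y :=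
    fun {m'} hm' hm'' Y => by
    rw [hH'', kernel_sub_aux₃, kernel_sub_aux₃, hHp, kernel_presented_of_ne 𝕜 _ Y (by omega), hHq,
      kernel_presented_of_ne 𝕜 _ Y (by omega), sub_zero, sub_zero]
  -- (1) the degree-`2p` kernel of `e^{Δ}H - H - ΔH` is that of `e^{Δ}H''`
  have hsplit : ∀ W : Fin (2 * p) → Γ, kernel 𝕜 (gaussConv 𝕜 C H - H - grassmannLaplacian 𝕜 C H) (2 * p) W =
      kernel 𝕜 (gaussConv 𝕜 C H'') (2 * p) W := fun W => by
    rw [kernel_gaussConv_sub_sub_laplacian_eq C H p W]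
  -- (2) the prescribed binomial–Gram bound for `H''`
  set N' : ℕ → ℕ → ℝ := fun m' F => if m' = p ∨ m' = p + 1 then 0 else N m' F with hN'
  have hN'0 : ∀ m' F, 0 ≤ N' m' F := fun m' F => by simp only [hN']; split_ifs; exacts [le_rfl, hN0 m' F]
  have hN'H : ∀ (m' : ℕ) (T : Finset (Fin (2 * p))), T ⊆ J → ∀ (ι : T → Fin (2 * m')), Function.Injective ι →
      ∀ (t : Fin (2 * m')), (∀ j, ι j ≠ t) → ∀ a : Γ,
        ∑ Y ∈ univ.filter (fun Y : Fin (2 * m') → Γ => Y t = a),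
          ‖kernel 𝕜 H'' (2 * m') Y‖ * wt (univ.image Y) * ∏ j : T, (if A j (Y (ι j)) = true then (1 : ℝ) else 0) ≤ N' m' T.card := by
    intro m' T hT ι hι t ht a
    by_cases hm' : m' = p
    · subst hm'
      simp only [hN', true_or, if_true, hkerH''_p, norm_zero, zero_mul, sum_const_zero, le_refl]
    · by_cases hm'' : m' = p + 1
      · subst hm''
        simp only [hN', or_true, if_true, hkerH''_q', norm_zero, zero_mul, sum_const_zero, le_refl]
      · simp only [hN', hm', hm'', or_self, if_false, hkerH''_ne hm' hm'']
        exact hN m' T hT ι hι t ht a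
  have h := sum_wt_norm_kernel_gaussConv_le_binomial_prescribed_of_gramBounded C hwt hκ hGB H'' hH''even J A N' hN'0 hN'H i hi w
  rw [sum_congr rfl fun W _ => by rw [hsplit W]]
  refine h.trans (sum_le_sum fun m' _ => ?_)
  simp only [hN']
  by_cases hm' : m' = p
  · subst hm'
    simp
  · by_cases hm'' : m' = p + 1
    · subst hm''
      simp
    · by_cases hlt : p + 1 < m'
      · rw [if_pos (by omega), if_neg (not_or.mpr ⟨hm', hm''⟩), if_pos hlt]
      · have hgt : ¬ 2 * p ≤ 2 * m' := by omega
        rw [if_neg hgt, if_neg hlt]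

end Literature.MathematicalPhysics.QuantumLattice
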